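import Literature.MathematicalPhysics.QuantumLattice.EmeryThreeBandThermalClusterVectorFloor
import HarnessLib

/-!
# The boundary-BOOSTED `Cu₄O₈` cluster by rank (device door for the three-band `T > 0` CAP at `k = 2`):
# `H^{w}_S[emeryInteraction θ]` relabelled onto `Fin 1 ×ₗ Fin 12` IS `hubbardOpenBoxGP 1 12 (boostTau θ) (blockUps θ) (blockNu θ)`,
# so ANY certified upper bound on that cluster's `log Re Tr e^{−βh^G}` caps `4·emeryCellPressure β θ`

Topic `Literature/MathematicalPhysics/QuantumLattice` (family `hubbard`; crew hubbard-fast S2 «multi-band × T > 0», seat hubbard-box-p1). The CAP door of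
`EmeryThreeBandThermalPressure` (`emeryCellPressure_le_log_partitionFn_boost_zero`, `k = 2`: `4·P_cell ≤ log Re Tr_S e^{−βH^{w,θ}_S}` with the uniform
`(2ℤ)²`-weight `w` of mass `4` on `[0,4)²`) and the generic sector-floor cap `PartitionFnSectorFloorCap.log_partitionFn_hubbardOpenBoxGP_le_of_sector_floors`
meet here: the boosted cluster operator is identified, by rank, with a general-pair cluster whose tables the kernel device reads (the sector-floor
reading `4·P_cell ≤ log Σ_{p,p'} C(12,p) C(12,p') e^{−βq_{p+p'}}` is the one-line composition with that file, recorded in its sequel).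

* §1 **PLACEMENT COUNTS OF THE BLOCK** (kernel-decided): a pair of block sites `{x, y}` has `c₀·c₁` even translates inside `[0,4)²`,
  `c_i = 1 + [max(x_i,y_i) ≤ 1] + [min(x_i,y_i) ≥ 2]` (`superlatPlacementCount_block_pair`); every single site has `4` (`…_single`). Hence the boost
  weights `cu4o8Boost k l = 4/(c₀c₁) ∈ {1, 2, 4}`: interior bonds `1`, the bonds `O_x(1,·)–Cu(2,·)`, `O_y(·,1)–Cu(·,2)` and their O–O partners `2`, the
  O–O bond `{(1,2),(2,1)}` `4`; all on-site weights `1`.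
* §2 **THE BOOSTED DICTIONARY**: `emeryTau w θ S ∘ f⁻¹ = boostTau θ := cu4o8Boost ⊙ blockTau θ`, `emeryUps w θ S ∘ f⁻¹ = blockUps θ`, `emeryNu w θ S ∘ f⁻¹ = blockNu θ`
  (`f = cu4o8SiteEquiv`, `S = emeryPhysSites block2x2`), so **`relabel_block_boost_emeryInteraction`**:
  `relabel (Orb.mapEquiv f) (H^w_S[emeryInteraction θ]) = hubbardOpenBoxGP 1 12 (boostTau θ) (blockUps θ) (blockNu θ)`.
* §3 **THE DEVICE CAP** (`emeryCellPressure_le_log_partitionFn_boostGP`): `4·emeryCellPressure β θ ≤ log Re Z_β(hubbardOpenBoxGP 1 12 (boostTau θ) (blockUps θ) (blockNu θ))`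
  (every real `β`); certified-number form `emeryCellPressure_le_of_log_partitionFn_boostGP_le` (`log Re Z ≤ u ⇒ P_cell ≤ u/4`); `boostTau_symm` (the device's
  symmetry hypothesis). Together with `le_emeryCellPressure_of_rayleighFamily` (same cluster, unboosted tables) this is the device-ready TWO-SIDED window
  on the three-band free energy per `CuO₂` at `T > 0`.

Everything is PROVED (0 sorry); definitions with bodies: `cu4o8PlaceAxis`, `cu4o8Count`, `cu4o8Boost`, `boostTau`. HONEST SCOPE: plumbing; no number; an
upper bound on the boosted cluster's log-partition function is the device's (e.g. `PartitionFnSectorFloorCap` from KCert sector floors — crude — or a thermal device).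

## Tree / Mathlib search

REUSED: `cu4o8Site(Equiv)`, `cu4o8AtomOf`, `hopIndNat_block`, `emeryAtomUNat/EpsNat_mul_coset_block`, `cu4o8Tau/Ups/Nu`, `block2x2` (`EmeryThreeBandBlock2x2RayleighCap`);
`blockTau/Ups/Nu` (`EmeryThreeBandThermalClusterVectorFloor`); `emeryTau/Ups/Nu`, `emeryAtomPairCoef/UCoef/ECoef`, `hopInd_eq_cast`, `emeryAtomU/Eps_eq_cast`,
`localHamiltonian_reweight_emeryInteraction_eq_generalPair`, `relabel_generalPairHamiltonian`, `hubbardOpenBoxGP_eq_generalPairHamiltonian` (`EmeryThreeBandGeneralPairForm`);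
`uniformPeriodicWeight`, `superlatPlacementCount` (`WeightedOpenClusterUniformWeightsPeriodic`); `emeryCellPressure_le_log_partitionFn_boost_zero`,
`emeryPhysSites`, `emeryInteraction_apply_eq_zero_of_not_subset_phys` (`EmeryThreeBandThermalPressure`, `…PhysClusterTrialCap`); `localHamiltonian_eq_fermionEmbed_of_support`,
`log_partitionFn_fermionEmbed`, `partitionFn_relabel`.

## References

* R. Valentí, J. Stolze, P. J. Hirschfeld, Phys. Rev. B 43 (1991) 13743, §II (inverse covering multiplicities). [cite: ValentiStolzeHirschfeld1991, §II]
* R. B. Israel, *Convexity in the Theory of Lattice Gases* (1979), Lemma II.3.1. [cite: Israel1979, Lemma II.3.1]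
* E. Pavarini et al., Phys. Rev. Lett. 87 (2001) 047003, eq. (1). [cite: PavariniEtAl2001, eq. (1)]
-/

noncomputable section

open scoped ComplexOrder BigOperators
open Finset

namespace Literature.MathematicalPhysics.QuantumLattice

open Matrix HubbardWave0 Literature.Probability.LatticeModels ThermodynamicLimit ClusterLowerBound InfVolFermionState

/-! ### §1. Placement counts of the block and the boost weights -/

/-- Per-axis even-placement count of a pair of coordinates `u, v ∈ [0,4)`: `1 + [max ≤ 1] + [min ≥ 2]`. [cite: ValentiStolzeHirschfeld1991, §II] -/
def cu4o8PlaceAxis (u v : ℤ) : ℕ := 1 + (if max u v ≤ 1 then 1 else 0) + (if 2 ≤ min u v then 1 else 0)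

/-- The number of even translates of the pair of block sites of ranks `k, l` inside `[0,4)²`. [cite: ValentiStolzeHirschfeld1991, §II] -/
def cu4o8Count (k l : Fin 12) : ℕ := cu4o8PlaceAxis (cu4o8Site k 0) (cu4o8Site l 0) * cu4o8PlaceAxis (cu4o8Site k 1) (cu4o8Site l 1)

/-- **THE PAIR PLACEMENT COUNTS OF THE BLOCK** (kernel-decided). [cite: ValentiStolzeHirschfeld1991, §II] -/
theorem superlatPlacementCount_block_pair (k l : Fin 12) :
    superlatPlacementCount liebPeriods (halfOpenBox 2 4) ({cu4o8Site k, cu4o8Site l} : Finset (Site 2)) = cu4o8Count k l := by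
  revert k l
  decide +kernel

/-- **Every block site has four even translates inside `[0,4)²`** (kernel-decided). [cite: ValentiStolzeHirschfeld1991, §II] -/
theorem superlatPlacementCount_block_single (k : Fin 12) :
    superlatPlacementCount liebPeriods (halfOpenBox 2 4) ({cu4o8Site k} : Finset (Site 2)) = 4 := by
  revert k
  decide +kernel

/-- The counts are positive (kernel-decided). [cite: ValentiStolzeHirschfeld1991, §II] -/
theorem cu4o8Count_pos (k l : Fin 12) : 0 < cu4o8Count k l := by
  unfold cu4o8Count cu4o8PlaceAxis
  positivity

/-- **The boost weight of a pair of ranks**: `4 / (even placements of the pair)` ∈ `{1, 2, 4}`. [cite: ValentiStolzeHirschfeld1991, §II] -/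
def cu4o8Boost (k l : Fin 12) : ℝ := 4 / (cu4o8Count k l : ℝ)

/-- **The boosted pair table**: `boostTau θ i j = cu4o8Boost · blockTau θ i j`. [cite: ValentiStolzeHirschfeld1991, §II] -/
def boostTau (θ : Fin 14 → ℝ) (i j : Fin 1 ×ₗ Fin 12) : ℝ := cu4o8Boost (ofLex i).2 (ofLex j).2 * blockTau θ i j

/-- The uniform weight of mass `4` of a pair of block sites is the boost weight. [cite: ValentiStolzeHirschfeld1991, §II] -/
theorem uniformPeriodicWeight_block_pair (k l : Fin 12) :
    uniformPeriodicWeight liebPeriods (halfOpenBox 2 4) 4 ({cu4o8Site k, cu4o8Site l} : Finset (Site 2)) = cu4o8Boost k l := by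
  rw [uniformPeriodicWeight, superlatPlacementCount_block_pair, cu4o8Boost]

/-- The uniform weight of mass `4` of a single block site is `1`. [cite: ValentiStolzeHirschfeld1991, §II] -/
theorem uniformPeriodicWeight_block_single (k : Fin 12) :
    uniformPeriodicWeight liebPeriods (halfOpenBox 2 4) 4 ({cu4o8Site k} : Finset (Site 2)) = 1 := by
  rw [uniformPeriodicWeight, superlatPlacementCount_block_single]
  norm_num

/-! ### §2. The boosted dictionary -/

/-- Every element of `Fin 1 ×ₗ Fin 12` is `(0, k)`. [folklore] -/
private theorem lex_eq_toLex_block (i : Fin 1 ×ₗ Fin 12) : i = toLex ((0 : Fin 1), (ofLex i).2) := by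
  rw [show (0 : Fin 1) = (ofLex i).1 from Subsingleton.elim _ _, Prod.mk.eta, toLex_ofLex]

/-- The weighted pair coefficient is the weight times the unweighted one. [cite: ValentiStolzeHirschfeld1991, §II] -/
theorem emeryAtomPairCoef_eq_weight_mul (w : Finset (Site 2) → ℝ) (Λ : Finset (Site 2)) (a : Fin 14) (p p' : PolySite Λ) :
    emeryAtomPairCoef w Λ a p p' = w {ofLex p.1, ofLex p'.1} * emeryAtomPairCoef (fun _ => 1) Λ a p p' := by
  unfold emeryAtomPairCoef
  rw [one_mul]

/-- The weighted repulsion coefficient is the weight times the unweighted one. [cite: ValentiStolzeHirschfeld1991, §II] -/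
theorem emeryAtomUCoef_eq_weight_mul (w : Finset (Site 2) → ℝ) (Λ : Finset (Site 2)) (a : Fin 14) (p : PolySite Λ) :
    emeryAtomUCoef w Λ a p = w {ofLex p.1} * emeryAtomUCoef (fun _ => 1) Λ a p := by
  unfold emeryAtomUCoef
  rw [one_mul]

/-- The weighted site-energy coefficient is the weight times the unweighted one. [cite: ValentiStolzeHirschfeld1991, §II] -/
theorem emeryAtomECoef_eq_weight_mul (w : Finset (Site 2) → ℝ) (Λ : Finset (Site 2)) (a : Fin 14) (p : PolySite Λ) :
    emeryAtomECoef w Λ a p = w {ofLex p.1} * emeryAtomECoef (fun _ => 1) Λ a p := by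
  unfold emeryAtomECoef
  rw [one_mul]

/-- Hence `emeryTau w = w{·,·} · emeryTau 1`. [cite: ValentiStolzeHirschfeld1991, §II] -/
theorem emeryTau_eq_weight_mul (w : Finset (Site 2) → ℝ) (θ : Fin 14 → ℝ) (Λ : Finset (Site 2)) (p p' : PolySite Λ) :
    emeryTau w θ Λ p p' = w {ofLex p.1, ofLex p'.1} * emeryTau (fun _ => 1) θ Λ p p' := by
  unfold emeryTau
  rw [Finset.mul_sum]
  exact Finset.sum_congr rfl fun a _ => by rw [emeryAtomPairCoef_eq_weight_mul]; ring

/-- `emeryUps w = w{·} · emeryUps 1`. [cite: ValentiStolzeHirschfeld1991, §II] -/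
theorem emeryUps_eq_weight_mul (w : Finset (Site 2) → ℝ) (θ : Fin 14 → ℝ) (Λ : Finset (Site 2)) (p : PolySite Λ) :
    emeryUps w θ Λ p = w {ofLex p.1} * emeryUps (fun _ => 1) θ Λ p := by
  unfold emeryUps
  rw [Finset.mul_sum]
  exact Finset.sum_congr rfl fun a _ => by rw [emeryAtomUCoef_eq_weight_mul]; ring

/-- `emeryNu w = w{·} · emeryNu 1`. [cite: ValentiStolzeHirschfeld1991, §II] -/
theorem emeryNu_eq_weight_mul (w : Finset (Site 2) → ℝ) (θ : Fin 14 → ℝ) (Λ : Finset (Site 2)) (p : PolySite Λ) :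
    emeryNu w θ Λ p = w {ofLex p.1} * emeryNu (fun _ => 1) θ Λ p := by
  unfold emeryNu
  rw [Finset.mul_sum]
  exact Finset.sum_congr rfl fun a _ => by rw [emeryAtomECoef_eq_weight_mul]; ring

/-- The unweighted pair coefficient at concrete sites, as a cast of the bond indicator. [cite: PavariniEtAl2001, eq. (1)] -/
private theorem emeryAtomPairCoef_one_pt' {Λ : Finset (Site 2)} (a : Fin 14) (x y : Site 2) (hx : x ∈ Λ) (hy : y ∈ Λ) :
    emeryAtomPairCoef (fun _ => 1) Λ a (PolySite.pt x hx) (PolySite.pt y hy) =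
      ((if a.1 < 8 then hopIndNat liebPeriods (emeryAtomCoset a) (emeryAtomVec a) x y else 0 : ℕ) : ℝ) := by
  unfold emeryAtomPairCoef
  rw [PolySite.ofLex_coe_pt, PolySite.ofLex_coe_pt, hopInd_eq_cast, one_mul]
  push_cast
  rfl

/-- The unweighted repulsion coefficient at a concrete site, as a cast. [cite: PavariniEtAl2001, eq. (1)] -/
private theorem emeryAtomUCoef_one_pt' {Λ : Finset (Site 2)} (a : Fin 14) (x : Site 2) (hx : x ∈ Λ) :
    emeryAtomUCoef (fun _ => 1) Λ a (PolySite.pt x hx) =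
      ((emeryAtomUNat a * (if InCoset liebPeriods (emeryAtomCoset a) x then 1 else 0) : ℕ) : ℝ) := by
  unfold emeryAtomUCoef
  rw [PolySite.ofLex_coe_pt, emeryAtomU_eq_cast, one_mul]
  push_cast
  rfl

/-- The unweighted site-energy coefficient at a concrete site, as a cast. [cite: PavariniEtAl2001, eq. (1)] -/
private theorem emeryAtomECoef_one_pt' {Λ : Finset (Site 2)} (a : Fin 14) (x : Site 2) (hx : x ∈ Λ) :
    emeryAtomECoef (fun _ => 1) Λ a (PolySite.pt x hx) =
      ((emeryAtomEpsNat a * (if InCoset liebPeriods (emeryAtomCoset a) x then 1 else 0) : ℕ) : ℝ) := by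
  unfold emeryAtomECoef
  rw [PolySite.ofLex_coe_pt, emeryAtomEps_eq_cast, one_mul]
  push_cast
  rfl

/-- **The unweighted pair coefficients of the block are the tables `blockTau`.** [cite: PavariniEtAl2001, eq. (1)] -/
theorem emeryTau_one_block (θ : Fin 14 → ℝ) (i j : Fin 1 ×ₗ Fin 12) :
    emeryTau (fun _ => 1) θ (emeryPhysSites block2x2) (cu4o8SiteEquiv.symm i) (cu4o8SiteEquiv.symm j) = blockTau θ i j := by
  rw [lex_eq_toLex_block i, lex_eq_toLex_block j]
  unfold emeryTau blockTau
  refine Finset.sum_congr rfl fun a _ => ?_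
  show θ a * emeryAtomPairCoef (fun _ => (1 : ℝ)) _ a (PolySite.pt (cu4o8Site (ofLex i).2) (cu4o8Site_mem _))
      (PolySite.pt (cu4o8Site (ofLex j).2) (cu4o8Site_mem _)) = _
  rw [emeryAtomPairCoef_one_pt', hopIndNat_block, cu4o8Tau]
  simp only [ofLex_toLex]
  push_cast
  rfl

/-- **The unweighted repulsion coefficients of the block are `blockUps`.** [cite: PavariniEtAl2001, eq. (1)] -/
theorem emeryUps_one_block (θ : Fin 14 → ℝ) (i : Fin 1 ×ₗ Fin 12) :
    emeryUps (fun _ => 1) θ (emeryPhysSites block2x2) (cu4o8SiteEquiv.symm i) = blockUps θ i := by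
  rw [lex_eq_toLex_block i]
  unfold emeryUps blockUps
  refine Finset.sum_congr rfl fun a _ => ?_
  show θ a * emeryAtomUCoef (fun _ => (1 : ℝ)) _ a (PolySite.pt (cu4o8Site (ofLex i).2) (cu4o8Site_mem _)) = _
  rw [emeryAtomUCoef_one_pt', emeryAtomUNat_mul_coset_block, cu4o8Ups]
  simp only [ofLex_toLex]
  push_cast
  rfl

/-- **The unweighted site-energy coefficients of the block are `blockNu`.** [cite: PavariniEtAl2001, eq. (1)] -/
theorem emeryNu_one_block (θ : Fin 14 → ℝ) (i : Fin 1 ×ₗ Fin 12) :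
    emeryNu (fun _ => 1) θ (emeryPhysSites block2x2) (cu4o8SiteEquiv.symm i) = blockNu θ i := by
  rw [lex_eq_toLex_block i]
  unfold emeryNu blockNu
  refine Finset.sum_congr rfl fun a _ => ?_
  show θ a * emeryAtomECoef (fun _ => (1 : ℝ)) _ a (PolySite.pt (cu4o8Site (ofLex i).2) (cu4o8Site_mem _)) = _
  rw [emeryAtomECoef_one_pt', emeryAtomEpsNat_mul_coset_block, cu4o8Nu]
  simp only [ofLex_toLex]
  push_cast
  rfl

/-- The underlying site of the rank-`i` block point. [folklore] -/
private theorem ofLex_symm_block (i : Fin 1 ×ₗ Fin 12) : ofLex (cu4o8SiteEquiv.symm i).1 = cu4o8Site (ofLex i).2 :=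
  cu4o8SiteEquiv_symm_apply i

/-- **THE BOOSTED PAIR TABLE**: with `w` the uniform weight of mass `4` on `[0,4)²`, `emeryTau w θ S ∘ f⁻¹ = boostTau θ`. [cite: ValentiStolzeHirschfeld1991, §II] -/
theorem emeryTau_boost_block (θ : Fin 14 → ℝ) (i j : Fin 1 ×ₗ Fin 12) :
    emeryTau (uniformPeriodicWeight liebPeriods (halfOpenBox 2 4) 4) θ (emeryPhysSites block2x2) (cu4o8SiteEquiv.symm i) (cu4o8SiteEquiv.symm j) =
      boostTau θ i j := by
  rw [emeryTau_eq_weight_mul, emeryTau_one_block, ofLex_symm_block, ofLex_symm_block, uniformPeriodicWeight_block_pair, boostTau]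

/-- **The boosted repulsion table is the unboosted one** (on-site weights `1`). [cite: ValentiStolzeHirschfeld1991, §II] -/
theorem emeryUps_boost_block (θ : Fin 14 → ℝ) (i : Fin 1 ×ₗ Fin 12) :
    emeryUps (uniformPeriodicWeight liebPeriods (halfOpenBox 2 4) 4) θ (emeryPhysSites block2x2) (cu4o8SiteEquiv.symm i) = blockUps θ i := by
  rw [emeryUps_eq_weight_mul, emeryUps_one_block, ofLex_symm_block, uniformPeriodicWeight_block_single, one_mul]

/-- **The boosted site-energy table is the unboosted one.** [cite: ValentiStolzeHirschfeld1991, §II] -/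
theorem emeryNu_boost_block (θ : Fin 14 → ℝ) (i : Fin 1 ×ₗ Fin 12) :
    emeryNu (uniformPeriodicWeight liebPeriods (halfOpenBox 2 4) 4) θ (emeryPhysSites block2x2) (cu4o8SiteEquiv.symm i) = blockNu θ i := by
  rw [emeryNu_eq_weight_mul, emeryNu_one_block, ofLex_symm_block, uniformPeriodicWeight_block_single, one_mul]

/-- **THE BOOSTED BLOCK DICTIONARY**: `relabel (Orb.mapEquiv f) (H^w_S[emeryInteraction θ]) = hubbardOpenBoxGP 1 12 (boostTau θ) (blockUps θ) (blockNu θ)`,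
`w` the uniform `(2ℤ)²`-weight of mass `4` on `[0,4)²`, `S` the twelve physical sites of the block. [cite: ValentiStolzeHirschfeld1991, §II] [cite: PavariniEtAl2001, eq. (1)] -/
theorem relabel_block_boost_emeryInteraction (θ : Fin 14 → ℝ) :
    relabel (Orb.mapEquiv cu4o8SiteEquiv)
        ((⟨fun X => (uniformPeriodicWeight liebPeriods (halfOpenBox 2 4) 4 X : ℂ) • (emeryInteraction θ).Φ X⟩ : FermionInteraction 2).localHamiltonian
          (emeryPhysSites block2x2)) =
      hubbardOpenBoxGP 1 12 (boostTau θ) (blockUps θ) (blockNu θ) := by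
  rw [localHamiltonian_reweight_emeryInteraction_eq_generalPair, relabel_generalPairHamiltonian, hubbardOpenBoxGP_eq_generalPairHamiltonian]
  have hτ : (fun i j => emeryTau (uniformPeriodicWeight liebPeriods (halfOpenBox 2 4) 4) θ (emeryPhysSites block2x2) (cu4o8SiteEquiv.symm i)
      (cu4o8SiteEquiv.symm j)) = boostTau θ := by
    funext i j; exact emeryTau_boost_block θ i j
  have hυ : (fun i => emeryUps (uniformPeriodicWeight liebPeriods (halfOpenBox 2 4) 4) θ (emeryPhysSites block2x2) (cu4o8SiteEquiv.symm i)) =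
      blockUps θ := by
    funext i; exact emeryUps_boost_block θ i
  have hν : (fun i => emeryNu (uniformPeriodicWeight liebPeriods (halfOpenBox 2 4) 4) θ (emeryPhysSites block2x2) (cu4o8SiteEquiv.symm i)) =
      blockNu θ := by
    funext i; exact emeryNu_boost_block θ i
  rw [hτ, hυ, hν]

/-! ### §3. The device cap -/

/-- The two descriptions of the `2×2`-cell block's physical sites agree (kernel-decided). [cite: PavariniEtAl2001, eq. (1)] -/
theorem emeryPhysSites_block2x2_eq_two : emeryPhysSites block2x2 = emeryPhysSites (fun _ : Fin 2 => 2 - 1) := by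
  have h : (block2x2 : Fin 2 → ℕ) = fun _ => 2 - 1 := by
    funext i; fin_cases i <;> rfl
  rw [h]

/-- **THE DEVICE CAP** (every real `β`): `4·emeryCellPressure β θ ≤ log Re Z_β(hubbardOpenBoxGP 1 12 (boostTau θ) (blockUps θ) (blockNu θ))`.
[cite: Israel1979, Lemma II.3.1] [cite: ValentiStolzeHirschfeld1991, §II] -/
theorem emeryCellPressure_le_log_partitionFn_boostGP (β : ℝ) (θ : Fin 14 → ℝ) :
    4 * emeryCellPressure β θ ≤ Real.log (Matrix.partitionFn β (hubbardOpenBoxGP 1 12 (boostTau θ) (blockUps θ) (blockNu θ))).re := by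
  -- the cap of `EmeryThreeBandThermalPressure` at `k = 2`
  have h := emeryCellPressure_le_log_partitionFn_boost_zero (le_refl 2) β θ
  have h4 : (((2 : ℕ) : ℝ) ^ 2) = 4 := by norm_num
  rw [h4] at h
  -- transport along the Finset identity `emeryPhysSites block2x2 = emeryPhysSites (fun _ => 2 - 1)` and relabel by rank
  set Ψw : FermionInteraction 2 := ⟨fun X => (uniformPeriodicWeight liebPeriods (halfOpenBox 2 4) 4 X : ℂ) • (emeryInteraction θ).Φ X⟩ with hΨw
  have hsub : emeryPhysSites block2x2 ⊆ emeryPhysSites (fun _ : Fin 2 => 2 - 1) := emeryPhysSites_block2x2_eq_two.le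
  have hemb : Ψw.localHamiltonian (emeryPhysSites (fun _ : Fin 2 => 2 - 1)) =
      fermionEmbed (PolySite.incl hsub) (Ψw.localHamiltonian (emeryPhysSites block2x2)) :=
    Ψw.localHamiltonian_eq_fermionEmbed_of_support hsub fun X hX hXS => absurd (emeryPhysSites_block2x2_eq_two ▸ hX) hXS
  have hHw : (Ψw.localHamiltonian (emeryPhysSites block2x2)).IsHermitian :=
    FermionInteraction.localHamiltonian_isHermitian ((emeryInteraction_structure θ).1.reweight _) _
  have hcard : #(emeryPhysSites (fun _ : Fin 2 => 2 - 1)) = #(emeryPhysSites block2x2) := by rw [emeryPhysSites_block2x2_eq_two]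
  have hZ : Real.log (Matrix.partitionFn β (Ψw.localHamiltonian (emeryPhysSites (fun _ : Fin 2 => 2 - 1)))).re =
      Real.log (Matrix.partitionFn β (hubbardOpenBoxGP 1 12 (boostTau θ) (blockUps θ) (blockNu θ))).re := by
    rw [hemb, log_partitionFn_fermionEmbed (PolySite.incl hsub) β hHw, card_orb_polySite, card_orb_polySite, hcard, Nat.sub_self, Nat.cast_zero,
      zero_mul, add_zero, ← relabel_block_boost_emeryInteraction θ, partitionFn_relabel]
  exact h.trans (le_of_eq hZ)

/-- `boostTau θ` is symmetric. [cite: ValentiStolzeHirschfeld1991, §II] -/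
theorem boostTau_symm (θ : Fin 14 → ℝ) (i j : Fin 1 ×ₗ Fin 12) : boostTau θ i j = boostTau θ j i := by
  rw [← emeryTau_boost_block, ← emeryTau_boost_block, emeryTau_symm]

/-- **Certified-number form**: `log Re Z_β(hubbardOpenBoxGP 1 12 (boostTau θ) (blockUps θ) (blockNu θ)) ≤ u` ⇒ `emeryCellPressure β θ ≤ u/4`.
[cite: Israel1979, Lemma II.3.1] -/
theorem emeryCellPressure_le_of_log_partitionFn_boostGP_le (β : ℝ) (θ : Fin 14 → ℝ) {u : ℝ}
    (hu : Real.log (Matrix.partitionFn β (hubbardOpenBoxGP 1 12 (boostTau θ) (blockUps θ) (blockNu θ))).re ≤ u) :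
    emeryCellPressure β θ ≤ u / 4 := by
  have h := (emeryCellPressure_le_log_partitionFn_boostGP β θ).trans hu
  linarith

end Literature.MathematicalPhysics.QuantumLattice

end
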